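import Mathlib
import HarnessLib
import Summits.AtomisticToContinuum.FouriersLaw.Theses.JunctionLocality
import Summits.AtomisticToContinuum.FouriersLaw.Theorems.JunctionLocalityConductanceLowerBoundStubBulkAbelFloorOfHeatVarianceBets

/-!
# (A⁻) from a shift-invariant Abelian Green–Kubo witness (crux stmt-AtomisticToContinuum-11749, line `abel-floor-exchange`)

Helper file (`--supports stmt-AtomisticToContinuum-11749`, lead c5).  Stub 1 of line abel-floor-exchange, `stub_openChainAbelFloor` (A⁻):
for `pinnedChain ω₂ lam β γ` (all `> 0`) and `T > 0`, an `N`-uniform floor `a·N ≤ F_N(ν) = ∫₀^∞ e^{−νt} c_N(t) dt` at every fixed small Abel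
frequency, `c_N` the open chain's equilibrium total-current autocorrelation.  The landed bridge `abelFloor_openChain_of_bulkWitness` (p156938) derives it
from a SHIFT-INVARIANT bulk Abel-floor witness.  This file records the second natural supplier, in the language of the Green–Kubo routes
(FourierGreenKubo stmt-0703, EmbeddedDrudeMourre stmt-12597 / AbelThermodynamicLimit family):

* `openChainAbelFloor_of_shiftInvariantAbelWitness` — if for all parameters `> 0` and `T > 0` there is an ABELIAN GREEN–KUBO WITNESS WITH SHIFT INVARIANCE
  (`μ_T` a shift-invariant DLR state, `D` a `μ_T`-preserving dynamics with absolutely convergent current correlations, `κ > 0` with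
  `(T²)⁻¹ ∫₀^∞ e^{−νt} C_T(t) dt → κ` as `ν ↓ 0`), then (A⁻) holds (order of the limit: `∫ e^{−νt} C_T ≥ κT²/2` for `ν < ν₀`, then the bridge).

Shift invariance is what the Green–Kubo route items (0703, 12597) do NOT state and what the bridge needs (one-site tightness ⇒ superstable uniqueness ⇒
fixed-frequency matching S3); so the typed gap between those items and (A⁻) is exactly "the witness state is shift-invariant (or tight)".
No new definitions, no named facts, no sorry.  References: folklore.
-/

noncomputable section

open MeasureTheory Filter Set Topology
open Literature.MathematicalPhysics.KineticTheory.HeatConduction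

namespace Summit.AtomisticToContinuum.FouriersLaw.Cruxes.ConductanceLowerBound.AbelFloorExchange

/-- **(A⁻) from a shift-invariant Abelian Green–Kubo witness.** [folklore] -/
theorem openChainAbelFloor_of_shiftInvariantAbelWitness
    (hW : ∀ ω₂ lam β γ : ℝ, 0 < ω₂ → 0 < lam → 0 < β → 0 < γ → ∀ T : ℝ, 0 < T →
      ∃ (μT : Measure ChainConfig) (D : InfiniteChainDynamics (pinnedChain ω₂ lam β γ)) (κ : ℝ),
        (pinnedChain ω₂ lam β γ).IsChainGibbsMeasure T μT ∧ IsShiftInvariant μT ∧ D.PreservesMeasure μT ∧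
        (∀ t : ℝ, D.HasAbsConvergentCorrelation μT t) ∧ 0 < κ ∧
        Tendsto (fun ν : ℝ => (T ^ 2)⁻¹ * ∫ t in Set.Ioi (0:ℝ), Real.exp (-(ν * t)) * D.currentCorrelation μT t)
          (𝓝[>] (0:ℝ)) (𝓝 κ)) :
    ∀ ω₂ lam β γ : ℝ, 0 < ω₂ → 0 < lam → 0 < β → 0 < γ → ∀ T : ℝ, 0 < T →
      ∃ a : ℝ, 0 < a ∧ ∃ ν₀ : ℝ, 0 < ν₀ ∧ ∀ ν : ℝ, 0 < ν → ν < ν₀ → ∃ N₀ : ℕ, ∀ N : ℕ, N₀ ≤ N →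
        a * N ≤ ∫ t in Set.Ioi (0:ℝ), Real.exp (-(ν * t)) *
          ∫ z, (∑ i : Fin N, (pinnedChain ω₂ lam β γ).bondCurrent N i z) *
            (∫ y, (∑ i : Fin N, (pinnedChain ω₂ lam β γ).bondCurrent N i y)
              ∂((pinnedChain ω₂ lam β γ).transitionKernel N T T t.toNNReal z))
            ∂((pinnedChain ω₂ lam β γ).gibbsMeasure N T) := by
  refine abelFloor_openChain_of_bulkWitness fun ω₂ lam β γ hω hl hβ hγ T hT => ?_
  obtain ⟨μT, D, κ, hG, hS, hP, hAC, hκ, hlim⟩ := hW ω₂ lam β γ hω hl hβ hγ T hT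
  -- order of the limit: eventually (T²)⁻¹ ∫ e^{−νt} C_T > κ/2 on a right neighbourhood (0, ν₀)
  have hev : ∀ᶠ ν in 𝓝[>] (0:ℝ), κ / 2 < (T ^ 2)⁻¹ * ∫ t in Set.Ioi (0:ℝ), Real.exp (-(ν * t)) * D.currentCorrelation μT t :=
    hlim.eventually (Ioi_mem_nhds (by linarith))
  rw [eventually_nhdsWithin_iff, Metric.eventually_nhds_iff] at hev
  obtain ⟨ν₀, hν₀, hball⟩ := hev
  have hT2 : 0 < T ^ 2 := by positivity
  refine ⟨μT, D, κ / 2 * T ^ 2, ν₀, hG, hS, hP, hAC, by positivity, hν₀, fun ν hν hlt => ?_⟩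
  have hdist : dist ν 0 < ν₀ := by rwa [dist_zero_right, Real.norm_eq_abs, abs_of_pos hν]
  have h := hball hdist hν
  have h' := (lt_inv_mul_iff₀ hT2).mp h
  linarith [h']

/-- Registered helper sub-goal `helper_openChainAbelFloorOfShiftInvariantAbelWitness` of stub `stub_openChainAbelFloor`
(= `openChainAbelFloor_of_shiftInvariantAbelWitness`; line abel-floor-exchange, crux stmt-AtomisticToContinuum-11749). [folklore] -/
theorem helper_openChainAbelFloorOfShiftInvariantAbelWitness : (∀ ω₂ lam β γ : ℝ, 0 < ω₂ → 0 < lam → 0 < β → 0 < γ → ∀ T : ℝ, 0 < T → ∃ (μT : Measure ChainConfig) (D : InfiniteChainDynamics (pinnedChain ω₂ lam β γ)) (κ : ℝ), (pinnedChain ω₂ lam β γ).IsChainGibbsMeasure T μT ∧ IsShiftInvariant μT ∧ D.PreservesMeasure μT ∧ (∀ t : ℝ, D.HasAbsConvergentCorrelation μT t) ∧ 0 < κ ∧ Tendsto (fun ν : ℝ => (T ^ 2)⁻¹ * ∫ t in Set.Ioi (0:ℝ), Real.exp (-(ν * t)) * D.currentCorrelation μT t) (𝓝[>] (0:ℝ))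 (𝓝 κ)) → ∀ ω₂ lam β γ : ℝ, 0 < ω₂ → 0 < lam → 0 < β → 0 < γ → ∀ T : ℝ, 0 < T → ∃ a : ℝ, 0 < a ∧ ∃ ν₀ : ℝ, 0 < ν₀ ∧ ∀ ν : ℝ, 0 < ν → ν < ν₀ → ∃ N₀ : ℕ, ∀ N : ℕ, N₀ ≤ N → a * N ≤ ∫ t in Set.Ioi (0:ℝ), Real.exp (-(ν * t)) * ∫ z, (∑ i : Fin N, (pinnedChain ω₂ lam β γ).bondCurrent N i z) * (∫ y, (∑ i : Fin N, (pinnedChain ω₂ lam β γ).bondCurrent N i y) ∂((pinnedChain ω₂ lam β γ).transitionKernel N T T t.toNNReal z)) ∂((pinnedChain ω₂ lam β γ).gibbsMeasure N T) :=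
  openChainAbelFloor_of_shiftInvariantAbelWitness

end Summit.AtomisticToContinuum.FouriersLaw.Cruxes.ConductanceLowerBound.AbelFloorExchange

end
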